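import Literature.Topology.FourManifolds.BCSOrientationGluing
import Literature.Topology.FourManifolds.SphereFamilySurgeryExistence
import Literature.Topology.FourManifolds.SphereSurgeryPi1
import Literature.Topology.FourManifolds.NullCobordismOrientedBy
import Literature.AlgebraicTopology.SingularHomology.OrientationCover
import HarnessLib

/-!
# The surgered null-cobordism is oriented: gluing `[W, ∂W]` with an orientation of the handle

Topic `Literature/Topology/FourManifolds` (fact seat of
`Literature.Topology.FourManifolds.HomotopySphere.exists_highlyConnected_of_mem_signatureSet`,
brick B7b).  J. Milnor, *Lectures on the h-cobordism theorem* (1965), §3 p. 21 and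
Kervaire–Milnor (1963), §5–§6: the manifold `χ(W, φ)` obtained by surgery from an oriented `W`
"has a natural orientation" (that of `W ∖ S` extended over the handle).  Homologically
(Hatcher 2002, §3.3 p. 253, Lemma 3.27), exactly as for the boundary connected sum in
`BCSOrientationGluing.lean`: the relative fundamental class `[W, ∂W]` restricts to a local
orientation of the open piece `W ∖ S ↪ χ`, the handle `OD^{k+1} × Sˡ ↪ χ` is simply connected
(`l ≥ 2`) hence `ℤ`-oriented (Hatcher Prop. 3.25), the two local orientations differ by a
constant sign on the CONNECTED overlap `Sᵏ × (Bˡ⁺¹ ∖ 0)` (`k ≥ 1`), and after fixing that sign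
they glue to an orientation of the interior of `χ`, which integrates to `[χ, ∂χ]`.

* `NullCobordism.OpenOrientedPiece…` (§1) — transport of the local classes of an ORIENTATION of a
  boundaryless open piece `jT : B → W_U` (the handle) to the interior manifold of `W_U`
  (generators, local consistency), the analogue of `NullCobordism.Piece` for a piece without
  boundary;
* `NullCobordism.exists_isRelFundamentalClass_of_piece_of_orientation` (§2) — gluing a relative
  fundamental class of a piece `Piece cS cU` with an orientation of an open oriented piece
  covering the rest of `W_U`, along a nonempty preconnected interior overlap;
* `NullCobordism.exists_isRelFundamentalClass_surgery` (§3) — **`χ(W, φ)` has a relative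
  fundamental class if `W` has one** (`k ≥ 1`, `l ≥ 2`), and with `NullCobordismOrientedBy.lean`:
  `NullCobordism.exists_isOrientedBy_surgery` — oriented-boundary data `(M, μ) = bW` pass to
  `(M, μ) = bχ(W, φ)`.

Everything is proved; the only definitions (with bodies) are the transported families of §1;
no named facts.

## References

* J. Milnor, *Lectures on the h-cobordism theorem* (1965), Def. 3.11, §3 p. 21.
  [MilnorHCobordism1965]
* M. Kervaire, J. Milnor, *Groups of homotopy spheres I*, Ann. of Math. 77 (1963), §5.
  [KervaireMilnorAnnals1963]
* A. Hatcher, *Algebraic Topology* (2002), §3.3 p. 253, Lemma 3.27, Prop. 3.25. [HatcherAT2002]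
-/

noncomputable section

open scoped Manifold ContDiff Topology
open Set Function Filter CategoryTheory Limits Topology
open Literature.AlgebraicTopology.SingularHomology

namespace Literature.Topology.FourManifolds

namespace NullCobordism

variable {m : ℕ}
variable {MU : Type} [TopologicalSpace MU] [ChartedSpace (EuclideanSpace ℝ (Fin (m + 1))) MU]
  [IsManifold (𝓡 (m + 1)) ∞ MU] [CompactSpace MU]

/-! ### §1 An open oriented piece without boundary and the transport of its local classes -/

section OpenOrientedPiece

variable (cU : NullCobordism (m + 1) MU) {B : Type} [TopologicalSpace B]
  (jT : C(B, cU.W)) (hjT : IsOpenEmbedding jT) (μB : HomologicalOrientation ℤ B (m + 1 + 1))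

open Classical in
/-- **The transported family of an oriented open piece**: at `z = jT b` the class
`(jT)_* (μ_b)`, zero off the image. [folklore] -/
def handleAmbientFamily : LocalFamily ℤ ℤ cU.W (m + 1 + 1) := fun z =>
  if h : z ∈ range jT then
    relativeSingularHomology.map ℤ ℤ jT
      (show MapsTo jT ({h.choose}ᶜ : Set B) ({z}ᶜ : Set cU.W) from by
        have e := h.choose_spec
        intro b hb hz
        exact hb (hjT.injective (hz.trans e.symm))) (m + 1 + 1) (μB.localClass h.choose)
  else 0

omit [IsManifold (𝓡 (m + 1)) ∞ MU] [CompactSpace MU] in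
/-- Values of the transported family on the image of the piece. [folklore] -/
theorem handleAmbientFamily_apply (b : B) :
    handleAmbientFamily cU jT hjT μB (jT b) =
      relativeSingularHomology.map ℤ ℤ jT (LocalFamily.mapsTo_compl_pt hjT.injective b) (m + 1 + 1)
        (μB.localClass b) := by
  have h : jT b ∈ range jT := mem_range_self b
  unfold handleAmbientFamily
  rw [dif_pos h]
  have key : ∀ (b' : B) (hb' : jT b' = jT b)
      (hm : MapsTo jT ({b'}ᶜ : Set B) ({jT b}ᶜ : Set cU.W)),
      relativeSingularHomology.map ℤ ℤ jT hm (m + 1 + 1) (μB.localClass b') =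
        relativeSingularHomology.map ℤ ℤ jT (LocalFamily.mapsTo_compl_pt hjT.injective b)
          (m + 1 + 1) (μB.localClass b) := by
    intro b' hb' hm
    cases hjT.injective hb'
    rfl
  exact key h.choose h.choose_spec _

/-- **The interior family of an oriented open piece** on `X_U = W_U ∖ ∂W_U`. [folklore] -/
def handleInteriorFamily : LocalFamily ℤ ℤ cU.Interior (m + 1 + 1) := fun v =>
  haveI := cU.isIso_map_val_local v (m + 1 + 1)
  inv (relativeSingularHomology.map ℤ ℤ cU.valCM (cU.mapsTo_val_compl_singleton v) (m + 1 + 1))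
    (handleAmbientFamily cU jT hjT μB v.val)

omit [IsManifold (𝓡 (m + 1)) ∞ MU] [CompactSpace MU] in
/-- `val_* (handleInteriorFamily v) = handleAmbientFamily v.val`. [folklore] -/
theorem map_val_handleInteriorFamily (v : cU.Interior) :
    relativeSingularHomology.map ℤ ℤ cU.valCM (cU.mapsTo_val_compl_singleton v) (m + 1 + 1)
      (handleInteriorFamily cU jT hjT μB v) = handleAmbientFamily cU jT hjT μB v.val := by
  haveI := cU.isIso_map_val_local v (m + 1 + 1)
  rw [handleInteriorFamily, ← ModuleCat.comp_apply, IsIso.inv_hom_id, ModuleCat.id_apply]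

omit [IsManifold (𝓡 (m + 1)) ∞ MU] [CompactSpace MU] in
/-- **The interior family of an oriented open piece consists of generators over its image.**
[folklore] -/
theorem isGenerator_handleInteriorFamily (b : B) (v : cU.Interior) (hv : v.val = jT b) :
    ∃ e : localHomology ℤ ℤ cU.Interior v (m + 1 + 1) ≃ₗ[ℤ] ℤ,
      e (handleInteriorFamily cU jT hjT μB v) = 1 := by
  haveI := cU.isIso_map_val_local v (m + 1 + 1)
  rw [← exists_linearEquiv_apply_eq_one_iff_of_isIso
    (relativeSingularHomology.map ℤ ℤ cU.valCM (cU.mapsTo_val_compl_singleton v) (m + 1 + 1)),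
    map_val_handleInteriorFamily]
  have hm : MapsTo jT ({b}ᶜ : Set B) ({v.val}ᶜ : Set cU.W) := by
    rw [hv]; exact LocalFamily.mapsTo_compl_pt hjT.injective b
  haveI := localHomology.isIso_map_of_isOpenEmbedding_of_eq ℤ ℤ jT hjT b hv.symm (m + 1 + 1)
  have hval : handleAmbientFamily cU jT hjT μB v.val =
      relativeSingularHomology.map ℤ ℤ jT hm (m + 1 + 1) (μB.localClass b) := by
    have key : ∀ (z : cU.W) (hz : z = jT b) (hm' : MapsTo jT ({b}ᶜ : Set B) ({z}ᶜ : Set cU.W)),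
        handleAmbientFamily cU jT hjT μB z =
          relativeSingularHomology.map ℤ ℤ jT hm' (m + 1 + 1) (μB.localClass b) := by
      intro z hz hm'
      subst hz
      exact handleAmbientFamily_apply cU jT hjT μB b
    exact key v.val hv hm
  rw [hval]
  exact (exists_linearEquiv_apply_eq_one_iff_of_isIso _ _).2 (μB.isGenerator b)

omit [IsManifold (𝓡 (m + 1)) ∞ MU] [CompactSpace MU] in
/-- **The interior family of an oriented open piece is consistent near every point of its
image** (transport of the local consistency of `μ_B` through `jT` and the excision of the
interior). [folklore] -/
theorem consistentOn_handleInteriorFamily_nhds [LocallyCompactSpace B]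
    (hint : ∀ b, jT b ∈ (𝓡∂ (m + 1 + 1)).interior cU.W) (b : B) (v : cU.Interior)
    (hv : v.val = jT b) :
    ∃ N ∈ 𝓝 v, (handleInteriorFamily cU jT hjT μB).ConsistentOn N := by
  -- a compact neighbourhood `K'` of `b` on which `μ_B` is consistent
  obtain ⟨N₀, hN₀, hcons₀⟩ := μB.consistentOn_nhds b
  obtain ⟨K', hK'n, hK'N, hK'c⟩ := local_compact_nhds hN₀
  have h2 : LocalFamily.ConsistentOn (μB.localClass : LocalFamily ℤ ℤ B (m + 1 + 1)) K' :=
    hcons₀.mono hK'N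
  -- push forward along `jT`
  have h3 : (handleAmbientFamily cU jT hjT μB).ConsistentOn (jT '' K') :=
    h2.image jT hjT.injective fun b' _ => handleAmbientFamily_apply cU jT hjT μB b'
  -- pull back to the interior manifold along `val`
  have hjK'int : jT '' K' ⊆ (𝓡∂ (m + 1 + 1)).interior cU.W := by
    rintro _ ⟨b', -, rfl⟩; exact hint b'
  set K'' : Set cU.Interior := InteriorManifold.val ⁻¹' (jT '' K') with hK''
  have hvalK'' : cU.valCM '' K'' = jT '' K' := by
    ext z; constructor
    · rintro ⟨u, hu, rfl⟩; exact hu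
    · intro hz; exact ⟨⟨z, hjK'int hz⟩, hz, rfl⟩
  have hjK'closed : IsClosed (jT '' K') := (hK'c.image jT.continuous).isClosed
  have h4 : (handleInteriorFamily cU jT hjT μB).ConsistentOn K'' := by
    refine LocalFamily.ConsistentOn.preimage_of_isOpenEmbedding
      (β := handleAmbientFamily cU jT hjT μB) cU.valCM InteriorManifold.isOpenEmbedding_val ?_ ?_ ?_
    · rw [hvalK'', hjK'closed.closure_eq]
      intro z hz
      exact ⟨⟨z, hjK'int hz⟩, rfl⟩
    · rw [hvalK'']; exact h3
    · intro u _
      exact (map_val_handleInteriorFamily cU jT hjT μB u).symm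
  refine ⟨K'', ?_, h4⟩
  have hjn : jT '' K' ∈ 𝓝 (jT b) := hjT.isOpenMap.image_mem_nhds hK'n
  rw [← hv] at hjn
  exact InteriorManifold.continuous_val.continuousAt.preimage_mem_nhds hjn

end OpenOrientedPiece

/-! ### §2 Gluing a relative fundamental class with an orientation of an open piece -/

section Gluing

variable {MS : Type} [TopologicalSpace MS] [ChartedSpace (EuclideanSpace ℝ (Fin (m + 1))) MS]
  [IsManifold (𝓡 (m + 1)) ∞ MS] [CompactSpace MS]
variable {cS : NullCobordism (m + 1) MS} {cU : NullCobordism (m + 1) MU}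

/-- **Gluing `[W_S, ∂W_S]` with an orientation of an open oriented piece** (Hatcher 2002, p. 253,
Lemma 3.27; Milnor 1965, §3 p. 21): let `S : Piece cS cU` and let `jT : B → W_U` be an open
embedding of a boundaryless oriented `B` into the interior of `W_U`, the two images covering `W_U`
and meeting the interior in a nonempty preconnected set.  If `(W_S, ∂W_S)` has a relative
fundamental class then so has `(W_U, ∂W_U)`. [cite: HatcherAT2002, §3.3 p. 253, Lemma 3.27] -/
theorem exists_isRelFundamentalClass_of_piece_of_orientation (S : Piece cS cU) {B : Type}
    [TopologicalSpace B] [LocallyCompactSpace B] (jT : C(B, cU.W)) (hjT : IsOpenEmbedding jT)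
    (hint : ∀ b, jT b ∈ (𝓡∂ (m + 1 + 1)).interior cU.W)
    (μB : HomologicalOrientation ℤ B (m + 1 + 1)) (hcov : range S.j ∪ range jT = univ)
    (hne : {v : cU.Interior | v.val ∈ range S.j ∩ range jT}.Nonempty)
    (hpre : IsPreconnected {v : cU.Interior | v.val ∈ range S.j ∩ range jT})
    {wS : relativeSingularHomology ℤ ℤ cS.W ((𝓡∂ (m + 1 + 1)).boundary cS.W) (m + 1 + 1)}
    (hwS : IsRelFundamentalClass ℤ ((𝓡∂ (m + 1 + 1)).boundary cS.W) wS) :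
    ∃ wU : relativeSingularHomology ℤ ℤ cU.W ((𝓡∂ (m + 1 + 1)).boundary cU.W) (m + 1 + 1),
      IsRelFundamentalClass ℤ ((𝓡∂ (m + 1 + 1)).boundary cU.W) wU := by
  classical
  set O : Set cU.Interior := {v : cU.Interior | v.val ∈ range S.j ∩ range jT} with hO
  have hOopen : IsOpen O :=
    (S.isOpenEmbedding_j.isOpen_range.inter hjT.isOpen_range).preimage
      InteriorManifold.continuous_val
  set νS := S.interiorFamily wS with hνS
  set νT := handleInteriorFamily cU jT hjT μB with hνT
  have genS : ∀ v : cU.Interior, v.val ∈ range S.j →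
      ∃ e : localHomology ℤ ℤ cU.Interior v (m + 1 + 1) ≃ₗ[ℤ] ℤ, e (νS v) = 1 := by
    rintro v ⟨x, hx⟩
    have hxint := BCSGluing.mem_interior_of_j_eq S hx
    rw [← ModelWithCorners.compl_boundary] at hxint
    exact S.isGenerator_interiorFamily hwS x hxint v hx.symm
  have genT : ∀ v : cU.Interior, v.val ∈ range jT →
      ∃ e : localHomology ℤ ℤ cU.Interior v (m + 1 + 1) ≃ₗ[ℤ] ℤ, e (νT v) = 1 := by
    rintro v ⟨b, hb⟩
    exact isGenerator_handleInteriorFamily cU jT hjT μB b v hb.symm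
  have consS : ∀ v : cU.Interior, v.val ∈ range S.j → ∃ N ∈ 𝓝 v, νS.ConsistentOn N := by
    rintro v ⟨x, hx⟩
    exact S.consistentOn_interiorFamily_nhds wS x (BCSGluing.mem_interior_of_j_eq S hx) v hx.symm
  have consT : ∀ v : cU.Interior, v.val ∈ range jT → ∃ N ∈ 𝓝 v, νT.ConsistentOn N := by
    rintro v ⟨b, hb⟩
    exact consistentOn_handleInteriorFamily_nhds cU jT hjT μB hint b v hb.symm
  -- the sign function on the overlap and its constancy
  have hsign := fun (v : cU.Interior) (hv : v ∈ O) =>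
    exists_units_smul_of_generators (genS v hv.1) (genT v hv.2)
  choose! εf hεf using hsign
  obtain ⟨v₀, hv₀⟩ := hne
  set ε : ℤˣ := εf v₀ with hε
  have hεconst : ∀ v ∈ O, εf v = ε := fun v hv =>
    LocalFamily.sign_eq_of_isPreconnected (EuclideanSpace ℝ (Fin (m + 1 + 1))) (β := νT) (β' := νS)
      hOopen hpre (fun u hu => consT u hu.2) (fun u hu => consS u hu.1)
      (fun u hu => genT u hu.2) (ε := εf)
      (fun u hu => (hεf u hu).trans (Int.cast_smul_eq_zsmul ℤ (εf u : ℤ) (νT u)).symm) hv hv₀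
  -- the glued family
  let β : LocalFamily ℤ ℤ cU.Interior (m + 1 + 1) := fun v =>
    if v.val ∈ range S.j then νS v else (ε : ℤ) • νT v
  have hβS : ∀ v : cU.Interior, v.val ∈ range S.j → β v = νS v := fun v hv => if_pos hv
  have hβT : ∀ v : cU.Interior, v.val ∈ range jT → β v = (ε : ℤ) • νT v := by
    intro v hvT
    by_cases hvS : v.val ∈ range S.j
    · rw [hβS v hvS, hεf v ⟨hvS, hvT⟩, hεconst v ⟨hvS, hvT⟩]
    · exact if_neg hvS
  have hcover : ∀ v : cU.Interior, v.val ∈ range S.j ∨ v.val ∈ range jT := fun v => by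
    have : v.val ∈ range S.j ∪ range jT := by rw [hcov]; exact mem_univ _
    exact this
  have hgen : ∀ v, ∃ e : localHomology ℤ ℤ cU.Interior v (m + 1 + 1) ≃ₗ[ℤ] ℤ, e (β v) = 1 := by
    intro v
    rcases hcover v with hvS | hvT
    · rw [hβS v hvS]; exact genS v hvS
    · rw [hβT v hvT]; exact SmoothOrientation.exists_linearEquiv_units_smul (genT v hvT) ε
  have hcons : ∀ v, ∃ N ∈ 𝓝 v, LocalFamily.ConsistentOn β N := by
    intro v
    by_cases hvS : v.val ∈ range S.j
    · obtain ⟨N, hN, mN, hmN⟩ := consS v hvS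
      have hOS : InteriorManifold.val ⁻¹' range S.j ∈ 𝓝 v :=
        (S.isOpenEmbedding_j.isOpen_range.preimage InteriorManifold.continuous_val).mem_nhds hvS
      refine ⟨N ∩ InteriorManifold.val ⁻¹' range S.j, Filter.inter_mem hN hOS,
        restrictLocal ℤ ℤ inter_subset_left _ mN, fun u hu => ?_⟩
      rw [restrictToPoint_restrictLocal_apply, hmN u hu.1, hβS u hu.2]
    · have hvT : v.val ∈ range jT := (hcover v).resolve_left hvS
      obtain ⟨N, hN, mN, hmN⟩ := consT v hvT
      have hOT : InteriorManifold.val ⁻¹' range jT ∈ 𝓝 v :=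
        (hjT.isOpen_range.preimage InteriorManifold.continuous_val).mem_nhds hvT
      refine ⟨N ∩ InteriorManifold.val ⁻¹' range jT, Filter.inter_mem hN hOT,
        (ε : ℤ) • restrictLocal ℤ ℤ inter_subset_left _ mN, fun u hu => ?_⟩
      rw [map_zsmul, restrictToPoint_restrictLocal_apply, hmN u hu.1, hβT u hu.2]
  set ν := HomologicalOrientation.ofLocalFamily β hgen hcons with hν
  obtain ⟨wU, hwU, -⟩ := cU.exists_isRelFundamentalClass_of_interiorOrientation ν
  exact ⟨wU, hwU⟩

end Gluing

/-! ### §3 The surgered null-cobordism -/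

section Surgery

variable {M : Type} [TopologicalSpace M] [ChartedSpace (EuclideanSpace ℝ (Fin (m + 1))) M]
  [IsManifold (𝓡 (m + 1)) ∞ M] [CompactSpace M]
  (c : NullCobordism (m + 1) M) {ι : Type} [Unique ι] {k l : ℕ}
  (ν : FramedSphereFamily (𝓡∂ (m + 1 + 1)) c.W ι k (l + 1)) (hkl : k + l = m + 1)

omit [IsManifold (𝓡 (m + 1)) ∞ M] [CompactSpace M] in
/-- The gluing maps of the surgered manifold (topological content of
`isOpenGluingWith_surgered`; private copy of `FramedSphereFamily.surgered_gluing` of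
`SphereSurgeryStep.lean`). [cite: MilnorHCobordism1965, Def. 3.11 (PDF p. 17)] -/
private theorem surgered_gluing' :
    IsOpenEmbedding (ν.glueData hkl).inl ∧
      IsOpenEmbedding ((ν.glueData hkl).inr ∘ SphereSurgery.toHandle ι k l hkl) ∧
      range (ν.glueData hkl).inl ∪ range ((ν.glueData hkl).inr ∘ SphereSurgery.toHandle ι k l hkl) =
        univ ∧
      ∀ a b, (ν.glueData hkl).inl a = ((ν.glueData hkl).inr ∘ SphereSurgery.toHandle ι k l hkl) b ↔
        sphereFamilySurgeryRel ν a b := by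
  have h := ν.isOpenGluingWith_surgered hkl
  exact ⟨⟨h.1.isEmbedding, h.2.1⟩, ⟨h.2.2.1.isEmbedding, h.2.2.2.1⟩, h.2.2.2.2.1, h.2.2.2.2.2⟩

/-- **The old piece `W ∖ S ↪ χ(W, φ)` of a surgery** as a `Piece` (boundary to boundary,
`inl_mem_boundary_surgered_iff`). [cite: MilnorHCobordism1965, Def. 3.11 (PDF p. 17)] -/
def surgeryPiece : Piece c (c.surgery ν hkl) where
  A := ν.complement
  j := ⟨(ν.glueData hkl).inl, (surgered_gluing' c ν hkl).1.continuous⟩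
  isOpenEmbedding_j := (surgered_gluing' c ν hkl).1
  mem_boundary_iff x := (ν.inl_mem_boundary_surgered_iff hkl x).symm

/-- The handle `ι × OD^{k+1} × Sˡ ↪ χ(W, φ)` of a surgery as a continuous map. [folklore] -/
def surgeryHandleMap : C(↥(ballTimesSphere ι k l), (c.surgery ν hkl).W) :=
  ⟨(ν.glueData hkl).inr ∘ SphereSurgery.toHandle ι k l hkl,
    (surgered_gluing' c ν hkl).2.1.continuous⟩

omit [CompactSpace M] in
/-- The handle of a surgery lies in the interior of the surgered manifold (its points glued to
`W ∖ S` are tube points, which are interior). [cite: MilnorHCobordism1965, §3 (PDF p. 21)] -/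
theorem surgeryHandleMap_mem_interior (b : ↥(ballTimesSphere ι k l)) :
    c.surgeryHandleMap ν hkl b ∈ (𝓡∂ (m + 1 + 1)).interior (c.surgery ν hkl).W := by
  rw [← ModelWithCorners.compl_boundary]
  intro hb
  change ((ν.glueData hkl).inr ∘ SphereSurgery.toHandle ι k l hkl) b ∈
    (𝓡∂ (m + 1 + 1)).boundary (ν.Surgered hkl) at hb
  rw [ν.boundary_surgered_eq hkl] at hb
  obtain ⟨a, ha, hab⟩ := hb
  obtain ⟨v, θ, -, -, hav⟩ := ((surgered_gluing' c ν hkl).2.2.2 a b).1 hab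
  have hint : (𝓡∂ (m + 1 + 1)).IsInteriorPoint (a : c.W) := by
    rw [hav]; exact ν.isInteriorPoint_apply hkl _ _
  have : (a : c.W) ∈ ((𝓡∂ (m + 1 + 1)).boundary c.W)ᶜ := by
    rw [ModelWithCorners.compl_boundary]; exact hint
  exact this ha

/-- **The surgered null-cobordism has a relative fundamental class if the original one has**
(`k ≥ 1`, `l ≥ 2`; Milnor 1965, §3 p. 21: `χ(W, φ)` is oriented compatibly with `W ∖ S`;
homological form, Hatcher 2002, p. 253): glue `[W, ∂W]|_{W ∖ S}` with a `ℤ`-orientation of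
the simply connected handle `OD^{k+1} × Sˡ` along the connected overlap `Sᵏ × (Bˡ⁺¹ ∖ 0)`.
[cite: MilnorHCobordism1965, §3 (PDF p. 21)] -/
theorem exists_isRelFundamentalClass_surgery (hk : 1 ≤ k) (hl : 2 ≤ l)
    {w : relativeSingularHomology ℤ ℤ c.W ((𝓡∂ (m + 1 + 1)).boundary c.W) (m + 1 + 1)}
    (hw : IsRelFundamentalClass ℤ ((𝓡∂ (m + 1 + 1)).boundary c.W) w) :
    ∃ w' : relativeSingularHomology ℤ ℤ (c.surgery ν hkl).W
        ((𝓡∂ (m + 1 + 1)).boundary (c.surgery ν hkl).W) (m + 1 + 1),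
      IsRelFundamentalClass ℤ ((𝓡∂ (m + 1 + 1)).boundary (c.surgery ν hkl).W) w' := by
  obtain ⟨hA, hB, hcov, hrel⟩ := surgered_gluing' c ν hkl
  -- the handle is oriented: it is simply connected, Hausdorff and Euclidean-charted (`HandleE`)
  haveI : SimplyConnectedSpace ↥(ballTimesSphere ι k l) :=
    FramedSphereFamily.simplyConnectedSpace_ballTimesSphere ι k hl
  haveI : SimplyConnectedSpace (SphereSurgery.HandleE ι k l hkl) :=
    inferInstanceAs (SimplyConnectedSpace ↥(ballTimesSphere ι k l))
  haveI : T2Space (SphereSurgery.HandleE ι k l hkl) :=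
    inferInstanceAs (T2Space ↥(ballTimesSphere ι k l))
  obtain ⟨μH⟩ := isOrientableOver_of_simplyConnectedSpace ℤ (SphereSurgery.HandleE ι k l hkl)
    (n := m + 1 + 1)
  let μB : HomologicalOrientation ℤ ↥(ballTimesSphere ι k l) (m + 1 + 1) := μH
  haveI : LocallyCompactSpace ↥(ballTimesSphere ι k l) :=
    (ballTimesSphere ι k l).isOpen.locallyCompactSpace
  -- the overlap is nonempty and preconnected
  obtain ⟨a₀, ha₀⟩ := FramedSphereFamily.exists_mem_gluedPart (ν := ν)
  have hjTint := c.surgeryHandleMap_mem_interior ν hkl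
  have hsub : range (c.surgeryPiece ν hkl).j ∩ range (c.surgeryHandleMap ν hkl) ⊆
      (𝓡∂ (m + 1 + 1)).interior (c.surgery ν hkl).W := by
    rintro _ ⟨-, ⟨b, rfl⟩⟩; exact hjTint b
  have himage : (InteriorManifold.val : (c.surgery ν hkl).Interior → (c.surgery ν hkl).W) ''
      {v | v.val ∈ range (c.surgeryPiece ν hkl).j ∩ range (c.surgeryHandleMap ν hkl)} =
      range (c.surgeryPiece ν hkl).j ∩ range (c.surgeryHandleMap ν hkl) := by
    ext z; constructor
    · rintro ⟨v, hv, rfl⟩; exact hv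
    · intro hz; exact ⟨⟨z, hsub hz⟩, hz, rfl⟩
  have hpc : IsPathConnected (range (c.surgeryPiece ν hkl).j ∩ range (c.surgeryHandleMap ν hkl)) :=
    FramedSphereFamily.isPathConnected_range_inter_range hA hrel hk (by omega)
  have hne : {v : (c.surgery ν hkl).Interior |
      v.val ∈ range (c.surgeryPiece ν hkl).j ∩ range (c.surgeryHandleMap ν hkl)}.Nonempty :=
    ⟨⟨(ν.glueData hkl).inl a₀, hsub ⟨mem_range_self a₀,
        FramedSphereFamily.apply_mem_range_jB hrel ha₀⟩⟩,
      ⟨mem_range_self a₀, FramedSphereFamily.apply_mem_range_jB hrel ha₀⟩⟩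
  have hpre : IsPreconnected {v : (c.surgery ν hkl).Interior |
      v.val ∈ range (c.surgeryPiece ν hkl).j ∩ range (c.surgeryHandleMap ν hkl)} := by
    rw [← (InteriorManifold.isEmbedding_val (I := 𝓡∂ (m + 1 + 1))
      (M := (c.surgery ν hkl).W)).isInducing.isPreconnected_image, himage]
    exact hpc.isConnected.isPreconnected
  exact exists_isRelFundamentalClass_of_piece_of_orientation (c.surgeryPiece ν hkl)
    (c.surgeryHandleMap ν hkl) hB hjTint μB hcov hne hpre hw

/-- **Oriented-boundary data pass through a surgery**: if `(M, μ) = bW` (`c.IsOrientedBy μ μ'`)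
and `M` is connected nonempty, then `(M, μ) = b χ(W, φ)` for some orientation `μ''` of the closed
model of the surgered null-cobordism (`k ≥ 1`, `l ≥ 2`). (Kervaire–Milnor 1963, §5–§7: surgery
does not change the oriented boundary.) [cite: KervaireMilnorAnnals1963, §7 (Thm. 7.5)] -/
theorem exists_isOrientedBy_surgery [T2Space M] [ConnectedSpace M] [Nonempty M] (hk : 1 ≤ k)
    (hl : 2 ≤ l)
    {μ : HomologicalOrientation ℤ M (m + 1)}
    {μ' : HomologicalOrientation ℤ (ClosedModel (m + 1) c.W) (m + 1 + 1)}
    (h : c.IsOrientedBy μ μ') :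
    ∃ μ'' : HomologicalOrientation ℤ (ClosedModel (m + 1) (c.surgery ν hkl).W) (m + 1 + 1),
      (c.surgery ν hkl).IsOrientedBy μ μ'' := by
  obtain ⟨w, hw, -, -⟩ := IsOrientedBy.exists_isRelFundamentalClass c (by omega) h
  obtain ⟨w', hw'⟩ := c.exists_isRelFundamentalClass_surgery ν hkl hk hl hw
  exact (c.surgery ν hkl).forall_exists_isOrientedBy_of_isRelFundamentalClass (by omega) hw' μ

end Surgery

end NullCobordism

end Literature.Topology.FourManifolds
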